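import Summits.ResolutionOfSingularities.ResolutionOfSingularities.Theorems.FrobeniusClosingSteerBetaGlueFrameX
import Summits.ResolutionOfSingularities.ResolutionOfSingularities.Theorems.FrobeniusClosingSteerBetaGlueFaceRegions
import Summits.ResolutionOfSingularities.ResolutionOfSingularities.Theorems.FrobeniusClosingSteerBetaGluePurify
import Summits.ResolutionOfSingularities.ResolutionOfSingularities.Theorems.FrobeniusClosingSteerBetaGlueDownstairsX
import Summits.ResolutionOfSingularities.ResolutionOfSingularities.Theorems.FrobeniusClosingSteerBetaHatLawWords
import Summits.ResolutionOfSingularities.ResolutionOfSingularities.Theorems.FrobeniusClosingSteerPrepDebtHatArithGlue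
import HarnessLib

/-!
# Crux `Steer` (stmt-ResolutionOfSingularities-16345), chain W4.1, β-LEAF, K-β2♭ part (III-X): the CORE of the glue
# `xLetterLawHat_of` — the star-level `x`-law at the `x`-chart ORIGIN (`c = 0`) from `PrepAttainHat`, `FacePrepAttainHat`,
# `VertexTheoremTwHat` and `PreparedTransferXHat` (def-free)

OURS (campaign `res-hironaka`, rung L ★L-G4, slot W4.1; statements about the route's own objects; they replace the
role of no printed item and are NOT statements of the manuscript under review [claim: Hironaka2017, status:
under-review]; AI review is weaker than expert review). Seat res-D-pv-003 (gen 7), K-β2♭ owner; GLUE (III) per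
res-L0-w41-plan-1 RULING 276(a).

`xLetterLaw_origin`: the conclusion `α₁ = δ − 1 ∧ β₁ ≤ β ∧ β₁ ≤ δ − α` of `XLetterLawHat` for a chart presentation `IsXChartHat … 0 …`.
Route: attain a representative prepared at `v* = (α, β)` (`hatt`, `hV`, orbit invariance, uniqueness); re-attain it face-prepared at
`w⁻ = (δ* − γ, γ)` (`hface`, `δ*` along the orbit); FRAME CORRECTION at the origin (`frame_xCoeff_mem_maximalIdeal`: the `x`-coefficients of
the frame change are non-units — the required absence of the point `(1, 0)` follows from `δ* > 1` or `γ > 0`, and the residual `δ* = 1 ∧ γ = 0`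
contradicts face-preparedness: moving back by `−c₁·x` and purifying reaches `DeltaFaceGt (1, 0)` in the `x`-near region); PURIFICATION of the
cleaning into the `x`-near ideal keeping `BetaGe`, `DeltaGe`, `DeltaFaceGe`; `hII` transfers face-preparedness to preparedness at `(δ − 1, γ)`
downstairs (with `γ ≤ δ − α`); `hV` downstairs, transport, uniqueness: `(α₁, β₁) = (δ − 1, γ)`; finally `γ ≤ β` from `δ ≤ α + β`.

[cite: CossartJannsenSaito2020, Lemma 12.1] [cite: CossartPiltant2019, Prop. 2.1 and 2.6] No Theses file is imported; nothing here is
a route item or a registration.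
-/

noncomputable section

-- `Summit.<S>.<S>.…` duplicates the summit name by design (single-problem summit).
set_option linter.dupNamespace false

namespace Summit.ResolutionOfSingularities.ResolutionOfSingularities.Theorems.SwitchingDichotomy.BetaHat

open IsLocalRing MvPolynomial
open Literature.AlgebraicGeometry.Resolution
open Literature.AlgebraicGeometry.Resolution.CossartPiltant (uPow uPow_mem_span_uPow minExponents)
open Summit.ResolutionOfSingularities.ResolutionOfSingularities.Theorems.SwitchingDichotomy.BetaPolygon
open Summit.ResolutionOfSingularities.ResolutionOfSingularities.Theorems.SwitchingDichotomy.BetaPolygonMoves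
  (isVStarTw_iff_of_isGaugeRepTw)
open Summit.ResolutionOfSingularities.ResolutionOfSingularities.Theorems.SwitchingDichotomy.BetaLetter (uPow_four range_four
  span_four_pow_eq_span_uPow)
open Summit.ResolutionOfSingularities.ResolutionOfSingularities.Theorems.SwitchingDichotomy.BetaNewton

/-- **CORE of GLUE (III-X): the star-level `x`-law at the `x`-chart origin.** See the module docstring.
[cite: CossartJannsenSaito2020, Lemma 12.1] -/
theorem xLetterLaw_origin (hatt : PrepAttainHat) (hface : FacePrepAttainHat) (hV : VertexTheoremTwHat)
    (hII : PreparedTransferXHat) (S S₁ : Type) [CommRing S] [IsLocalRing S] [CharP S 2] [CommRing S₁] [IsLocalRing S₁]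
    [CharP S₁ 2] (φ : S →+* S₁) (σ : ResidueField S →+* S) (σ₁ : ResidueField S₁ →+* S₁) (x y z w u f : S)
    (v₁ z₁ w₁ u₁ f₁ : S₁) (d k : ℕ) (α β δ α₁ β₁ : ℚ) (hS : IsHatRing S) (hS₁ : IsHatRing S₁) (hodd : Odd d) (h3 : 3 ≤ d)
    (hA : IsArithStage S x y z w u f d) (hX : IsXChartHat φ σ σ₁ x y z w 0 v₁ z₁ w₁)
    (hrad : φ (u * f) = φ x ^ (2 * k) * (u₁ * f₁)) (hA₁ : IsArithStage S₁ (φ x) v₁ z₁ w₁ u₁ f₁ d)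
    (hVf : IsVStarTw u x y z w d α β f) (hδ : IsDeltaStarTw u x y z w d δ f) (hV₁ : IsVStarTw u₁ (φ x) v₁ z₁ w₁ d α₁ β₁ f₁) :
    α₁ = δ - 1 ∧ β₁ ≤ β ∧ β₁ ≤ δ - α := by
  classical
  have hS' := hS; have hS₁' := hS₁; have hA' := hA; have hA₁' := hA₁; have hX' := hX
  obtain ⟨-, hreg, -, hdim, hperf⟩ := hS'
  obtain ⟨-, hreg₁, -, hdim₁, -⟩ := hS₁'
  obtain ⟨hspan, ⟨a, b, ha, hb, hu⟩, Ψ, hΨ, hroot, hfΨ⟩ := hA'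
  obtain ⟨hspan₁, ⟨a₁, b₁, ha₁, hb₁, hu₁⟩, Ψ₁, hΨ₁, hroot₁, hfΨ₁⟩ := hA₁'
  obtain ⟨hσ, hσ₁, hcompat, hpoly, -, hy', hz, hw⟩ := hX'
  have hy : φ y = φ x * v₁ := by simpa using hy'
  haveI := hreg
  haveI := hreg₁
  haveI : IsDomain S₁ := isDomain_of_isRegularLocalRing S₁
  have hd : 0 < d := by omega
  have h2 : (2 : S) = 0 := by simpa using CharP.cast_eq_zero S 2
  have ht : IsRsopPart ![x, y, z, w] := isRsopPart_four hreg hdim hspan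
  have ht₁ : IsRsopPart ![φ x, v₁, z₁, w₁] := isRsopPart_four hreg₁ hdim₁ hspan₁
  -- ### the strict transform of `f` is `f₁`; `b₁ = b`, `2k + a₁ = a + b + d`; the `x`-near region
  have hΨd := coeff_single_notMem_of_rootless hΨ (hroot 1 0 (Or.inl one_ne_zero))
  have hΨ₁d := coeff_single_notMem_of_rootless hΨ₁ (hroot₁ 1 0 (Or.inl one_ne_zero))
  have hfd : f ∈ maximalIdeal S ^ d := mem_pow_of_cone hspan hd hΨ hfΨ
  have hf₁d : f₁ ∈ maximalIdeal S₁ ^ d := mem_pow_of_cone hspan₁ hd hΨ₁ hfΨ₁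
  have hcf := single_two_mem_minExponents_of_cone ht hspan hΨ hΨd hfΨ
  have hcf₁ := single_two_mem_minExponents_of_cone ht₁ hspan₁ hΨ₁ hΨ₁d hfΨ₁
  obtain ⟨g, hg⟩ := exists_strictTransformX φ hy hz hw (d := d) (f := f) (by rw [hspan]; exact hfd)
  have hgf : g * φ x ^ d = φ f := by rw [hg, mul_comm]
  obtain ⟨-, htr2⟩ := minExponents_strictTransformX φ ht ht₁ hspan hspan₁ hy hz hw hfd hgf
  obtain ⟨ag, hag, hagle⟩ := htr2 _ hcf
  obtain ⟨k0, k1, -, -⟩ := (le_transportX_iff _ ag d).mp hagle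
  have hag0 : ag 0 = 0 := by simpa using k0
  have hag1 : ag 1 = 0 := by simpa using k1
  obtain ⟨hgf₁, hb₁b, hk⟩ := strictTransform_eq_of_radicand_X φ ht₁ hy hu hu₁ hg hrad hag hag0 hag1 hcf₁ (by simp) (by simp)
  have hf : f₁ * φ x ^ d = φ f := by rw [hg, hgf₁, mul_comm]
  have hnear := forall_minExponents_nearX φ ht ht₁ hspan hspan₁ hy hz hw hfd hf hf₁d
  have hfG : f ∈ Ideal.span (uPow ![x, y, z, w] '' {e | 2 * d ≤ ∑ l, (![1, 2, 2, 2] : Fin 4 → ℕ) l * e l}) :=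
    mem_of_forall_minExponents_uPow_mem ht fun e he => uPow_mem_span_uPow _ (by
      simp only [Set.mem_setOf_eq, sum_four, Matrix.cons_val_zero, Matrix.cons_val_one, Matrix.cons_val]
      have := hnear e he; omega)
  -- ### attain `v*`, then `w⁻`
  have hfin : ¬ AlphaStarGeTw u x y z w d (α + 1) f := by
    rintro ⟨z', w', f', hrep, hAl⟩
    have := hVf.2.1 z' w' f' (α + 1) hrep hAl
    linarith
  obtain ⟨α', β', z', w', f', hrep', hAst', hprep', -⟩ := hatt S x y z w u f d (α + 1) hS hodd h3 hA hfin
  have hVrep := hV S x y z' w' u f' d α' β' hS hodd h3 hAst' hprep'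
  obtain ⟨hαeq, hβeq⟩ := isVStarTw_unique hVf ((isVStarTw_iff_of_isGaugeRepTw hrep' d α' β').mp hVrep)
  rw [hαeq, hβeq] at hprep'
  obtain ⟨δ', γ, z'', w'', f'', hrep'', hAst'', hprep'', hfprep'', hδ', -⟩ :=
    hface S x y z' w' u f' d α β hS hodd h3 hAst' hprep'
  have hδeq : δ' = δ := isDeltaStarTw_unique hδ ((isDeltaStarTw_iff_of_isGaugeRepTw hrep' d δ').mp hδ')
  rw [hδeq] at hfprep''
  have hrep : IsGaugeRepTw u x y z w f z'' w'' f'' := isGaugeRepTw_trans hrep' hrep''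
  -- ### the frame change and the cleaning
  obtain ⟨hz''mem, hw''mem, q, hf''q⟩ := hrep
  obtain ⟨c₁, c₂, hc⟩ := Ideal.mem_span_pair.mp hz''mem
  obtain ⟨c₁', c₂', hc'⟩ := Ideal.mem_span_pair.mp hw''mem
  have hz'' : z'' = z + c₁ * x + c₂ * y := by
    have : z'' = z + (c₁ * x + c₂ * y) := by rw [hc]; ring
    rw [this]; ring
  have hw'' : w'' = w + c₁' * x + c₂' * y := by
    have : w'' = w + (c₁' * x + c₂' * y) := by rw [hc']; ring
    rw [this]; ring
  obtain ⟨hspan'', -, Ψ'', hΨ'', hroot'', hfΨ''⟩ := hAst''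
  obtain ⟨hα, hβ, hAl'', hBe'', -, hnd''⟩ := hprep''
  obtain ⟨hγ, hDG'', hFG'', hnFGt'', hnfd''⟩ := hfprep''
  have ht'' : IsRsopPart ![x, y, z'', w''] := isRsopPart_four hreg hdim hspan''
  have hf''d : f'' ∈ maximalIdeal S ^ d := mem_pow_of_cone hspan'' hd hΨ'' hfΨ''
  have hf''u : f'' = f + x ^ a * y ^ b * q ^ 2 := by rw [hf''q, hu]
  -- ### `δ ≥ 1`
  have hδ1 : 1 ≤ δ := hδ.2 1 ⟨z, w, f, isGaugeRepTw_refl u x y z w f, deltaGe_one_of_mem_pow ht hspan hfd⟩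
  -- ### weight bookkeeping for base changes (ω = (1, 2, 2, 2))
  have hωm : ∀ l : Fin 4, 1 ≤ (![1, 2, 2, 2] : Fin 4 → ℕ) l := by intro l; fin_cases l <;> simp
  have hbase : ∀ {zz ww e₁ e₂ : S}, Ideal.span {x, y, zz, ww} = maximalIdeal S → z = zz - e₁ → w = ww - e₂ →
      e₁ ∈ Ideal.span (uPow ![x, y, zz, ww] '' {e | 2 ≤ ∑ l, (![1, 2, 2, 2] : Fin 4 → ℕ) l * e l}) →
      e₂ ∈ Ideal.span (uPow ![x, y, zz, ww] '' {e | 2 ≤ ∑ l, (![1, 2, 2, 2] : Fin 4 → ℕ) l * e l}) →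
      f ∈ Ideal.span (uPow ![x, y, zz, ww] '' {e | 2 * d ≤ ∑ l, (![1, 2, 2, 2] : Fin 4 → ℕ) l * e l}) := by
    intro zz ww e₁ e₂ hsp hzz hww he₁ he₂
    refine span_uPow_wIdeal_le_of_frame ![x, y, z, w] ![x, y, zz, ww] ![1, 2, 2, 2] (fun l => ?_) (2 * d) hfG
    fin_cases l
    · exact param_mem_wIdeal ![x, y, zz, ww] ![1, 2, 2, 2] 0
    · exact param_mem_wIdeal ![x, y, zz, ww] ![1, 2, 2, 2] 1
    · show z ∈ _
      rw [hzz]; exact sub_mem (param_mem_wIdeal ![x, y, zz, ww] ![1, 2, 2, 2] 2) he₁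
    · show w ∈ _
      rw [hww]; exact sub_mem (param_mem_wIdeal ![x, y, zz, ww] ![1, 2, 2, 2] 3) he₂
  have hyW : ∀ (zz ww : S) (c : S), c * y ∈
      Ideal.span (uPow ![x, y, zz, ww] '' {e | 2 ≤ ∑ l, (![1, 2, 2, 2] : Fin 4 → ℕ) l * e l}) := fun zz ww c =>
    Ideal.mul_mem_left _ _ (param_mem_wIdeal ![x, y, zz, ww] ![1, 2, 2, 2] 1)
  -- ### the residual case `δ = 1 ∧ γ = 0` contradicts face-preparedness
  have hspecial : ¬ (δ = 1 ∧ γ = 0) := by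
    rintro ⟨hδone, hγ0⟩
    -- the frame moved back by `−c₁·x`
    have hspan''' : Ideal.span {x, y, z + c₂ * y, w + c₂' * y} = maximalIdeal S := by
      rw [span_four_move_eq x y z w (Ideal.mul_mem_left _ _ (Ideal.subset_span (by simp)))
        (Ideal.mul_mem_left _ _ (Ideal.subset_span (by simp))), hspan]
    have ht''' : IsRsopPart ![x, y, z + c₂ * y, w + c₂' * y] := isRsopPart_four hreg hdim hspan'''
    have hfG''' := hbase hspan''' (zz := z + c₂ * y) (ww := w + c₂' * y) (e₁ := c₂ * y) (e₂ := c₂' * y)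
      (by ring) (by ring) (hyW _ _ c₂) (hyW _ _ c₂')
    have hε : uPow ![x, y, z + c₂ * y, w + c₂' * y] ![a, b, 0, 0] = x ^ a * y ^ b := by rw [uPow_four]; simp
    have huniv : f + uPow ![x, y, z + c₂ * y, w + c₂' * y] ![a, b, 0, 0] * q ^ 2 ∈
        Ideal.span (uPow ![x, y, z + c₂ * y, w + c₂' * y] '' Set.univ) := by
      have : (1 : S) ∈ Ideal.span (uPow ![x, y, z + c₂ * y, w + c₂' * y] '' Set.univ) := by
        have h1 : (1 : S) = uPow ![x, y, z + c₂ * y, w + c₂' * y] 0 := by simp [uPow]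
        rw [h1]; exact uPow_mem_span_uPow _ (Set.mem_univ _)
      rw [Ideal.eq_top_of_isUnit_mem _ this isUnit_one]; exact Submodule.mem_top
    obtain ⟨q', r, hG', -, hrel⟩ := exists_purified_region ht''' (G := {e | 2 * d ≤ ∑ l, (![1, 2, 2, 2] : Fin 4 → ℕ) l * e l})
      (R := Set.univ) (fun b' a' hle hb' => by
        simp only [Set.mem_setOf_eq, sum_four, Matrix.cons_val_zero, Matrix.cons_val_one, Matrix.cons_val] at hb' ⊢
        have k0 : b' 0 ≤ a' 0 := hle 0; have k1 : b' 1 ≤ a' 1 := hle 1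
        have k2 : b' 2 ≤ a' 2 := hle 2; have k3 : b' 3 ≤ a' 3 := hle 3
        omega) (fun _ _ _ _ => Set.mem_univ _) ![a, b, 0, 0] hfG''' huniv
    rw [hε] at hG' hrel
    have hGt : DeltaFaceGt x y (z + c₂ * y) (w + c₂' * y) d 1 0 (f + x ^ a * y ^ b * q' ^ 2) := by
      refine deltaFaceGt_one_zero_of_nearX ht''' fun e he => ?_
      obtain ⟨g₀, hg₀, hle⟩ := exists_le_of_mem_span_uPow ht''' hG' he
      simp only [Set.mem_setOf_eq, sum_four, Matrix.cons_val_zero, Matrix.cons_val_one, Matrix.cons_val] at hg₀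
      have k0 : g₀ 0 ≤ e 0 := hle 0; have k1 : g₀ 1 ≤ e 1 := hle 1
      have k2 : g₀ 2 ≤ e 2 := hle 2; have k3 : g₀ 3 ≤ e 3 := hle 3
      omega
    refine hnfd'' (Or.inr ⟨1, 0, ⟨by rw [hδone]; norm_num, by rw [hγ0]; norm_num⟩, -c₁, -c₁', r, ?_⟩)
    have e1 : z'' + -c₁ * x ^ 1 * y ^ 0 = z + c₂ * y := by rw [hz'']; ring
    have e2 : w'' + -c₁' * x ^ 1 * y ^ 0 = w + c₂' * y := by rw [hw'']; ring
    have e3 : f'' + u * r ^ 2 = f + x ^ a * y ^ b * q' ^ 2 := by rw [hrel, hf''u, hu]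
    rw [e1, e2, e3, hδone, hγ0]
    exact hGt
  -- ### no point `(1, 0)` in slot `d − 1`
  have hno : ∀ e : Fin 4 → ℕ, e 0 = d - 1 → e 1 = 0 → e 2 + e 3 = 1 →
      e ∉ minExponents ![x, y, z'', w''] (f + x ^ a * y ^ b * q ^ 2) := by
    intro e he0 he1 he23 he
    rw [← hf''u] at he
    have hm : d - e 2 - e 3 = d - 1 := by omega
    have hpos : (0 : ℚ) < ((d - 1 : ℕ) : ℚ) := by exact_mod_cast (show 0 < d - 1 by omega)
    rcases forall_minExponents_of_deltaFaceGe ht'' (by linarith) hγ hFG'' _ he with h | h | ⟨h1, h2'⟩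
    · omega
    · rw [hm, he0, he1, add_zero] at h
      have : δ * ((d - 1 : ℕ) : ℚ) < ((d - 1 : ℕ) : ℚ) := by exact_mod_cast Nat.lt_of_floor_lt (Nat.lt_of_succ_le h)
      nlinarith
    · rw [hm, he0, he1, add_zero] at h1; rw [hm, he1] at h2'
      have hδle : δ * ((d - 1 : ℕ) : ℚ) ≤ ((d - 1 : ℕ) : ℚ) := by exact_mod_cast Nat.ceil_le.mp h1
      have hγle : γ * ((d - 1 : ℕ) : ℚ) ≤ ((0 : ℕ) : ℚ) := by exact_mod_cast Nat.ceil_le.mp h2'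
      push_cast at hγle
      have hδ1' : δ ≤ 1 := by nlinarith
      have hγ0 : γ ≤ 0 := by nlinarith
      exact hspecial ⟨le_antisymm hδ1' hδ1, le_antisymm hγ0 hγ⟩
  have hno2 : (![d - 1, 0, 1, 0] : Fin 4 → ℕ) ∉ minExponents ![x, y, z'', w''] (f + x ^ a * y ^ b * q ^ 2) :=
    hno _ (by simp) (by simp) (by simp)
  have hno3 : (![d - 1, 0, 0, 1] : Fin 4 → ℕ) ∉ minExponents ![x, y, z'', w''] (f + x ^ a * y ^ b * q ^ 2) :=
    hno _ (by simp) (by simp) (by simp)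
  -- ### frame correction: the `x`-coefficients are non-units
  obtain ⟨hc₁, hc₁'⟩ := frame_xCoeff_mem_maximalIdeal hreg hdim hspan hodd h3 hΨ hroot hfΨ hnear hz'' hw''
    (q := q) (by rw [← hf''u]; exact hf''d) hno2 hno3
  -- ### purification in the frame `t″`
  have hF1 := maximalIdeal_le_wIdeal hspan'' ![1, 2, 2, 2] (m := 1) hωm
  have hxW : ∀ c : S, c ∈ maximalIdeal S → c * x ∈
      Ideal.span (uPow ![x, y, z'', w''] '' {e | 2 ≤ ∑ l, (![1, 2, 2, 2] : Fin 4 → ℕ) l * e l}) := fun c hc =>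
    wIdeal_mul_le _ ![1, 2, 2, 2] 1 1 (Ideal.mul_mem_mul (hF1 hc) (param_mem_wIdeal ![x, y, z'', w''] ![1, 2, 2, 2] 0))
  have hfG'' := hbase hspan'' (zz := z'') (ww := w'') (e₁ := c₁ * x + c₂ * y) (e₂ := c₁' * x + c₂' * y)
    (by rw [hz'']; ring) (by rw [hw'']; ring) (add_mem (hxW c₁ hc₁) (hyW _ _ c₂)) (add_mem (hxW c₁' hc₁') (hyW _ _ c₂'))
  -- the region: `BetaGe (α, β) ∩ DeltaGe δ ∩ DeltaFaceGe (δ, γ)`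
  set R : Set (Fin 4 → ℕ) := {e | (d ≤ e 2 + e 3 ∨ ⌊α * ((d - e 2 - e 3 : ℕ) : ℚ)⌋₊ + 1 ≤ e 0 ∨
      (⌈α * ((d - e 2 - e 3 : ℕ) : ℚ)⌉₊ ≤ e 0 ∧ ⌈β * ((d - e 2 - e 3 : ℕ) : ℚ)⌉₊ ≤ e 1)) ∧
    (d ≤ e 2 + e 3 ∨ ⌈δ * ((d - e 2 - e 3 : ℕ) : ℚ)⌉₊ ≤ e 0 + e 1) ∧
    (d ≤ e 2 + e 3 ∨ ⌊δ * ((d - e 2 - e 3 : ℕ) : ℚ)⌋₊ + 1 ≤ e 0 + e 1 ∨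
      (⌈δ * ((d - e 2 - e 3 : ℕ) : ℚ)⌉₊ ≤ e 0 + e 1 ∧ ⌈γ * ((d - e 2 - e 3 : ℕ) : ℚ)⌉₊ ≤ e 1))} with hR
  have hRmono : ∀ b' a' : Fin 4 → ℕ, b' ≤ a' → b' ∈ R → a' ∈ R := by
    rintro b' a' hle ⟨h1, h2', h3'⟩
    exact ⟨betaRegion_mono hα hβ hle h1, deltaRegion_mono (by linarith) hle h2',
      deltaFaceRegion_mono (by linarith) hγ hle h3'⟩
  have hε : uPow ![x, y, z'', w''] ![a, b, 0, 0] = x ^ a * y ^ b := by rw [uPow_four]; simp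
  have hBq : f + uPow ![x, y, z'', w''] ![a, b, 0, 0] * q ^ 2 ∈ Ideal.span (uPow ![x, y, z'', w''] '' R) := by
    rw [hε, ← hf''u]
    refine mem_of_forall_minExponents_uPow_mem ht'' fun e he => uPow_mem_span_uPow _ ⟨?_, ?_, ?_⟩
    · exact (betaGe_iff_forall_minExponents ht'' hα hβ _).mp hBe'' e he
    · exact forall_minExponents_of_deltaGe ht'' (by linarith) hDG'' e he
    · exact forall_minExponents_of_deltaFaceGe ht'' (by linarith) hγ hFG'' e he
  obtain ⟨q'', r, hG3, hR3, hfrel⟩ := exists_purified_region ht'' (fun b' a' hle hb' => by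
      simp only [Set.mem_setOf_eq, sum_four, Matrix.cons_val_zero, Matrix.cons_val_one, Matrix.cons_val] at hb' ⊢
      have k0 : b' 0 ≤ a' 0 := hle 0; have k1 : b' 1 ≤ a' 1 := hle 1
      have k2 : b' 2 ≤ a' 2 := hle 2; have k3 : b' 3 ≤ a' 3 := hle 3
      omega) hRmono ![a, b, 0, 0] hfG'' hBq
  rw [hε] at hG3 hR3 hfrel
  obtain ⟨f₃, hf₃⟩ : ∃ f₃ : S, f₃ = f + x ^ a * y ^ b * q'' ^ 2 := ⟨_, rfl⟩
  rw [← hf₃] at hG3 hR3 hfrel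
  have hfrel' : f₃ = f'' + u * r ^ 2 := by rw [hfrel, hf''u, hu]
  have hR3' : ∀ e ∈ minExponents ![x, y, z'', w''] f₃, e ∈ R := fun e he => by
    obtain ⟨g₀, hg₀, hle⟩ := exists_le_of_mem_span_uPow ht'' hR3 he
    exact hRmono _ _ hle hg₀
  -- ### `f₃` is prepared, face-prepared and an arithmetic stage datum in the frame `(z″, w″)`
  have hsqadd : ∀ q₂ : S, f'' + u * (r + q₂) ^ 2 = f₃ + u * q₂ ^ 2 := by
    intro q₂; rw [hfrel', add_sq]; linear_combination (u * r * q₂) * h2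
  have hBe₃ : BetaGe x y z'' w'' d α β f₃ :=
    (betaGe_iff_forall_minExponents ht'' hα hβ _).mpr fun e he => (hR3' e he).1
  have hAl₃ : AlphaGe x z'' w'' d α f₃ := by
    refine (alphaGe_iff_forall_minExponents ht'' hα _).mpr fun e he => ?_
    rcases (hR3' e he).1 with h | h | ⟨h, -⟩
    · exact Or.inl h
    · exact Or.inr ((Nat.ceil_le_floor_add_one _).trans h)
    · exact Or.inr h
  have hDG₃ : DeltaGe x y z'' w'' d δ f₃ := deltaGe_of_forall_minExponents ht'' δ fun e he => (hR3' e he).2.1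
  have hFG₃ : DeltaFaceGe x y z'' w'' d δ γ f₃ := deltaFaceGe_of_forall_minExponents ht'' δ γ fun e he => (hR3' e he).2.2
  have hnGt₃ : ¬ BetaGt x y z'' w'' d α β f₃ := fun h => hnd'' (Or.inl ⟨r, by rw [← hfrel']; exact h⟩)
  have hnd₃ : ¬ IsDissolvableTwAt u x y z'' w'' d α β f₃ := by
    rintro (⟨q₂, h⟩ | ⟨aa, bb, hab, e₁, e₂, q₂, h⟩)
    · exact hnd'' (Or.inl ⟨r + q₂, by rw [hsqadd]; exact h⟩)
    · exact hnd'' (Or.inr ⟨aa, bb, hab, e₁, e₂, r + q₂, by rw [hsqadd]; exact h⟩)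
  have hnFGt₃ : ¬ DeltaFaceGt x y z'' w'' d δ γ f₃ := fun h => hnfd'' (Or.inl ⟨r, by rw [← hfrel']; exact h⟩)
  have hnfd₃ : ¬ IsFaceDissolvableTwAt u x y z'' w'' d δ γ f₃ := by
    rintro (⟨q₂, h⟩ | ⟨aa, bb, hab, e₁, e₂, q₂, h⟩)
    · exact hnfd'' (Or.inl ⟨r + q₂, by rw [hsqadd]; exact h⟩)
    · exact hnfd'' (Or.inr ⟨aa, bb, hab, e₁, e₂, r + q₂, by rw [hsqadd]; exact h⟩)
  have hprep₃ : IsPreparedTwAt u x y z'' w'' d α β f₃ := ⟨hα, hβ, hAl₃, hBe₃, hnGt₃, hnd₃⟩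
  have hfprep₃ : IsFacePreparedTwAt u x y z'' w'' d δ γ f₃ := ⟨hγ, hDG₃, hFG₃, hnFGt₃, hnfd₃⟩
  have hnear₃ : ∀ e ∈ minExponents ![x, y, z'', w''] f₃, 2 * d ≤ e 0 + 2 * e 1 + 2 * e 2 + 2 * e 3 := by
    intro e he
    obtain ⟨g₀, hg₀, hle⟩ := exists_le_of_mem_span_uPow ht'' hG3 he
    simp only [Set.mem_setOf_eq, sum_four, Matrix.cons_val_zero, Matrix.cons_val_one, Matrix.cons_val] at hg₀
    have k0 : g₀ 0 ≤ e 0 := hle 0; have k1 : g₀ 1 ≤ e 1 := hle 1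
    have k2 : g₀ 2 ≤ e 2 := hle 2; have k3 : g₀ 3 ≤ e 3 := hle 3
    omega
  have hf₃d : f₃ ∈ maximalIdeal S ^ d := by
    refine (mem_pow_iff_forall_minExponents ht'' hspan'' d _).mpr fun e he => ?_
    have := hnear₃ e he; rw [sum_four]; omega
  have hur : u * r ^ 2 ∈ Ideal.span {x, y} * maximalIdeal S ^ (d - 1) ⊔ maximalIdeal S ^ (d + 1) := by
    have hmem : uPow ![x, y, z'', w''] ![a, b, 0, 0] * r ^ 2 ∈ maximalIdeal S ^ d := by
      rw [hε, ← hu]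
      have : u * r ^ 2 = f₃ - f'' := by rw [hfrel']; ring
      rw [this]; exact sub_mem hf₃d hf''d
    have := twistedSq_mem_coneCorrection ht'' hspan'' hodd (ε := ![a, b, 0, 0]) (by simp) (by simp) hmem
    rwa [hε, ← hu] at this
  have hfΨ₃ : f₃ - eval ![z'', w''] Ψ'' ∈ Ideal.span {x, y} * maximalIdeal S ^ (d - 1) ⊔ maximalIdeal S ^ (d + 1) := by
    have : f₃ - eval ![z'', w''] Ψ'' = (f'' - eval ![z'', w''] Ψ'') + u * r ^ 2 := by rw [hfrel']; ring
    rw [this]; exact add_mem hfΨ'' hur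
  have hAst₃ : IsArithStage S x y z'' w'' u f₃ d := ⟨hspan'', ⟨a, b, ha, hb, hu⟩, Ψ'', hΨ'', hroot'', hfΨ₃⟩
  -- ### the downstairs frame
  obtain ⟨e₁, he₁⟩ := exists_map_eq_mul_of_mem_maximalIdeal_X φ hspan hy hz hw hc₁
  obtain ⟨e₁', he₁'⟩ := exists_map_eq_mul_of_mem_maximalIdeal_X φ hspan hy hz hw hc₁'
  obtain ⟨z₁'', hz₁''⟩ : ∃ z₁'' : S₁, z₁'' = z₁ + (φ x * e₁ + φ c₂ * v₁) := ⟨_, rfl⟩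
  obtain ⟨w₁'', hw₁''⟩ : ∃ w₁'' : S₁, w₁'' = w₁ + (φ x * e₁' + φ c₂' * v₁) := ⟨_, rfl⟩
  have hzφ : φ z'' = φ x * z₁'' := by
    rw [hz'', map_add, map_add, map_mul, map_mul, hz, hy, he₁, hz₁'']; ring
  have hwφ : φ w'' = φ x * w₁'' := by
    rw [hw'', map_add, map_add, map_mul, map_mul, hw, hy, he₁', hw₁'']; ring
  have hδmem : ∀ e c : S₁, φ x * e + c * v₁ ∈ Ideal.span ({φ x, v₁} : Set S₁) := fun e c =>
    add_mem (Ideal.mul_mem_right _ _ (Ideal.subset_span (by simp))) (Ideal.mul_mem_left _ _ (Ideal.subset_span (by simp)))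
  have hspan₁'' : Ideal.span {φ x, v₁, z₁'', w₁''} = maximalIdeal S₁ := by
    rw [hz₁'', hw₁'', span_four_move_eq (φ x) v₁ z₁ w₁ (hδmem _ _) (hδmem _ _), hspan₁]
  have ht₁'' : IsRsopPart ![φ x, v₁, z₁'', w₁''] := isRsopPart_four hreg₁ hdim₁ hspan₁''
  have hX'' : IsXChartHat φ σ σ₁ x y z'' w'' 0 v₁ z₁'' w₁'' := ⟨hσ, hσ₁, hcompat, hpoly, hspan₁'', hy', hzφ, hwφ⟩
  -- ### the downstairs element
  obtain ⟨g'', hg''⟩ := exists_strictTransformX φ hy hzφ hwφ (d := d) (f := f₃) (by rw [hspan'']; exact hf₃d)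
  have hg''f : g'' * φ x ^ d = φ (f + x ^ a * y ^ b * q'' ^ 2) := by rw [← hf₃, hg'', mul_comm]
  have hab : a + b ≤ d := by omega
  obtain ⟨q₁'', hq₁''⟩ := strictTransform_cleaning_eq_X φ ht₁ hy hk ha₁ hab hf hg''f
  have hg''u : g'' = f₁ + u₁ * q₁'' ^ 2 := by rw [hq₁'', hu₁, hb₁b]
  have hrad'' : φ (u * f₃) = φ x ^ (2 * k) * (u₁ * g'') := by
    have hpow : φ x ^ a * φ x ^ b * φ x ^ d = φ x ^ (2 * k) * φ x ^ a₁ := by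
      rw [← pow_add, ← pow_add, ← pow_add, hk]
    rw [map_mul, hg'', hu, hu₁, hb₁b, map_mul, map_pow, map_pow, hy]
    calc φ x ^ a * (φ x * v₁) ^ b * (φ x ^ d * g'') = v₁ ^ b * g'' * (φ x ^ a * φ x ^ b * φ x ^ d) := by ring
      _ = v₁ ^ b * g'' * (φ x ^ (2 * k) * φ x ^ a₁) := by rw [hpow]
      _ = φ x ^ (2 * k) * (φ x ^ a₁ * v₁ ^ b * g'') := by ring
  -- ### the downstairs arithmetic stage datum
  have hg''d : g'' ∈ maximalIdeal S₁ ^ d :=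
    strictTransform_mem_pow_of_nearX φ ht'' ht₁'' hspan'' hspan₁'' hy hzφ hwφ hf₃d (by rw [hg'', mul_comm]) hnear₃
  have hx₁y : Ideal.span ({φ x, v₁} : Set S₁) ≤ maximalIdeal S₁ := by
    rw [← hspan₁]
    exact Ideal.span_mono (Set.insert_subset_insert (Set.singleton_subset_iff.mpr (Set.mem_insert _ _)))
  have hz₁m : z₁ ∈ maximalIdeal S₁ := by rw [← hspan₁]; exact Ideal.subset_span (by simp)
  have hw₁m : w₁ ∈ maximalIdeal S₁ := by rw [← hspan₁]; exact Ideal.subset_span (by simp)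
  have hz₁''m : z₁'' ∈ maximalIdeal S₁ := by rw [hz₁'']; exact add_mem hz₁m (hx₁y (hδmem _ _))
  have hw₁''m : w₁'' ∈ maximalIdeal S₁ := by rw [hw₁'']; exact add_mem hw₁m (hx₁y (hδmem _ _))
  have hdz : z₁ - z₁'' ∈ Ideal.span ({φ x, v₁} : Set S₁) := by
    rw [hz₁'', sub_add_cancel_left]; exact neg_mem (hδmem _ _)
  have hdw : w₁ - w₁'' ∈ Ideal.span ({φ x, v₁} : Set S₁) := by
    rw [hw₁'', sub_add_cancel_left]; exact neg_mem (hδmem _ _)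
  have hΨtr : eval ![z₁, w₁] Ψ₁ - eval ![z₁'', w₁''] Ψ₁ ∈ Ideal.span {φ x, v₁} * maximalIdeal S₁ ^ (d - 1) := by
    refine eval_sub_eval_mem_mul_pow hΨ₁ (by omega) (a := ![z₁, w₁]) (b := ![z₁'', w₁'']) ?_ ?_ ?_
    · intro i; fin_cases i
      · exact hdz
      · exact hdw
    · intro i; fin_cases i
      · exact hz₁m
      · exact hw₁m
    · intro i; fin_cases i
      · exact hz₁''m
      · exact hw₁''m
  have hε₁ : uPow ![φ x, v₁, z₁'', w₁''] ![a₁, b₁, 0, 0] = u₁ := by rw [uPow_four, hu₁]; simp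
  have hu₁sq : u₁ * q₁'' ^ 2 ∈ Ideal.span {φ x, v₁} * maximalIdeal S₁ ^ (d - 1) ⊔ maximalIdeal S₁ ^ (d + 1) := by
    have hmem : uPow ![φ x, v₁, z₁'', w₁''] ![a₁, b₁, 0, 0] * q₁'' ^ 2 ∈ maximalIdeal S₁ ^ d := by
      rw [hε₁]
      have : u₁ * q₁'' ^ 2 = g'' - f₁ := by rw [hg''u]; ring
      rw [this]; exact sub_mem hg''d hf₁d
    have := twistedSq_mem_coneCorrection ht₁'' hspan₁'' hodd (ε := ![a₁, b₁, 0, 0]) (by simp) (by simp) hmem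
    rwa [hε₁] at this
  have hcone₁'' : g'' - eval ![z₁'', w₁''] Ψ₁ ∈
      Ideal.span {φ x, v₁} * maximalIdeal S₁ ^ (d - 1) ⊔ maximalIdeal S₁ ^ (d + 1) := by
    have hsum := add_mem (add_mem hfΨ₁ (Ideal.mem_sup_left hΨtr)) hu₁sq
    have hsplit : g'' - eval ![z₁'', w₁''] Ψ₁ =
        (f₁ - eval ![z₁, w₁] Ψ₁) + (eval ![z₁, w₁] Ψ₁ - eval ![z₁'', w₁''] Ψ₁) + u₁ * q₁'' ^ 2 := by
      rw [hg''u]; ring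
    rw [hsplit]; exact hsum
  have hAst₁'' : IsArithStage S₁ (φ x) v₁ z₁'' w₁'' u₁ g'' d :=
    ⟨hspan₁'', ⟨a₁, b₁, ha₁, hb₁, hu₁⟩, Ψ₁, hΨ₁, hroot₁, hcone₁''⟩
  -- ### transfer, read, transport
  obtain ⟨hγδα, hprep₁, -⟩ := hII S S₁ φ σ σ₁ x y z'' w'' u f₃ v₁ z₁'' w₁'' u₁ g'' d k α δ γ hS hS₁ hodd h3 hAst₃ hX''
    hrad'' hAst₁'' hAl₃ hfprep₃
  have hV₁'' := hV S₁ (φ x) v₁ z₁'' w₁'' u₁ g'' d (δ - 1) γ hS₁ hodd h3 hAst₁'' hprep₁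
  have hrep₁ : IsGaugeRepTw u₁ (φ x) v₁ z₁ w₁ f₁ z₁'' w₁'' g'' := by
    refine ⟨?_, ?_, q₁'', hg''u⟩
    · rw [hz₁'', add_sub_cancel_left]; exact hδmem _ _
    · rw [hw₁'', add_sub_cancel_left]; exact hδmem _ _
  obtain ⟨e1, e2⟩ := isVStarTw_unique ((isVStarTw_iff_of_isGaugeRepTw hrep₁ d (δ - 1) γ).mp hV₁'') hV₁
  -- ### `γ ≤ β` from `δ ≤ α + β` (a vertex exponent of `f₃` lies on or above the `δ`-line)
  have hδαβ : δ ≤ α + β := by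
    have hex : ∃ c ∈ minExponents ![x, y, z'', w''] f₃,
        ¬ (d ≤ c 2 + c 3 ∨ ⌊α * ((d - c 2 - c 3 : ℕ) : ℚ)⌋₊ + 1 ≤ c 0 ∨
          (⌈α * ((d - c 2 - c 3 : ℕ) : ℚ)⌉₊ ≤ c 0 ∧ ⌊β * ((d - c 2 - c 3 : ℕ) : ℚ)⌋₊ + 1 ≤ c 1)) := by
      by_contra hne
      push Not at hne
      exact hnGt₃ ((betaGt_iff_forall_minExponents ht'' hα hβ _).mpr hne)
    obtain ⟨cv, hcv, hPcv⟩ := hex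
    obtain ⟨hzwv, hcv0, hcv1⟩ := exponent_eq_of_betaGe_of_not_betaGt hα hβ ((hR3' cv hcv).1) hPcv
    rcases (hR3' cv hcv).2.1 with h | h
    · omega
    · set m : ℕ := d - cv 2 - cv 3 with hm
      have hm0 : (0 : ℚ) < m := by exact_mod_cast (show 0 < m by omega)
      have hle : δ * (m : ℚ) ≤ ((cv 0 + cv 1 : ℕ) : ℚ) := by exact_mod_cast Nat.ceil_le.mp h
      push_cast at hle
      rw [hcv0, hcv1] at hle
      have : δ * (m : ℚ) ≤ (α + β) * m := by linarith
      exact le_of_mul_le_mul_right this hm0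
  refine ⟨e1, ?_, by rw [e2]; exact hγδα⟩
  rw [e2]; linarith

end Summit.ResolutionOfSingularities.ResolutionOfSingularities.Theorems.SwitchingDichotomy.BetaHat

end
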